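import Literature.Analysis.FluidPDE.AncientMildWeak
import Literature.Analysis.FunctionSpaces.DiagonalWeakLimits
import HarnessLib

/-!
# Passage to the limit in the KNSS zoom-in: extraction and the limit bounded weak solution

Analysis/FluidPDE support file (proved lemmas) for the discharge path of
`Literature.Analysis.FluidPDE.KNSS2009_regularity_bound_C_over_r` (Koch–Nadirashvili–Seregin–Šverák
2009, Thm. 6.1). The printed proof (arXiv:0709.3599, p. 12, with Lemma 6.1 p. 11) extracts from
the rescaled solutions `v^{(k)}`, defined on `ℝ³ × (A_k, 0]` with `A_k → −∞` and `|v^{(k)}| ≤ γ_k`,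
a subsequence converging locally uniformly to a bounded ancient solution `v`. This file proves
the three elementary ingredients of that passage to the limit, in the generality in which they
hold:

* `exists_strictMono_tendsto_of_lipschitzWith` — **Arzelà–Ascoli, pointwise form**: a sequence
  of maps from a separable metric space to a proper metric space which is uniformly bounded and
  uniformly `K`-Lipschitz has a subsequence converging at every point, to a `K`-Lipschitz limit
  (diagonal extraction over a countable dense set, `exists_strictMono_forall_tendsto`, and the
  extension by equicontinuity, `forall_exists_tendsto_of_subset_closure`, both accepted in
  `Literature.Analysis.FunctionSpaces.DiagonalWeakLimits`);
* `isBoundedWeakNSSolutionOn_of_tendsto` — **limits of bounded weak solutions are bounded weak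
  solutions**: if `V k` is a bounded weak solution of Navier–Stokes (KNSS 2009, §4 (ii),
  `IsBoundedWeakNSSolutionOn`) on `ℝⁿ × (A_k, 0)`, continuous on its open slab, with
  `‖V k‖ ≤ M` and `A_k → −∞`, and `V k → v` pointwise on `(−∞, 0) × ℝⁿ` with `v` continuous,
  then `v` is a bounded weak solution on `ℝⁿ × (−∞, 0)` (dominated convergence in the weak
  formulation on the compact support of each test field, which lies in `(A_k, 0) × ℝⁿ` for `k`
  large; this is the only property of the limit that Lemma 6.1 is used for in the proof of
  Theorem 6.1, pointwise convergence being enough);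
* `forall_eq_zero_of_ae_slice_eq_zero` — a continuous field on `ℝ × ℝ³` whose slices vanish
  a.e. for a.e. `t < 0` (the conclusion of KNSS's Theorem 5.3) vanishes identically on
  `(−∞, 0] × ℝ³` (including the final time, by continuity).

## References

* G. Koch, N. Nadirashvili, G. Seregin, V. Šverák, *Liouville theorems for the Navier–Stokes
  equations and applications*, Acta Math. 203 (2009) = arXiv:0709.3599: §4 (ii) p. 8, Lemma 4.1
  p. 8, Lemma 6.1 p. 11, proof of Theorem 6.1 p. 12. [KochNadirashviliSereginSverak2009]
-/

noncomputable section

open MeasureTheory Set Function Filter Topology TopologicalSpace Metric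
open scoped RealInnerProductSpace Laplacian NNReal

namespace Literature.Analysis.FluidPDE

/-! ### Arzelà–Ascoli, pointwise form, for uniformly Lipschitz bounded sequences -/

section Extraction

/-- **Pointwise Arzelà–Ascoli for uniformly Lipschitz, uniformly bounded sequences.** Let `X` be
a separable (pseudo)metric space, `F` a proper metric space, and `x n : X → F` maps which are
all `K`-Lipschitz and take values in one closed ball. Then along some subsequence `x (φ n) t`
converges for every `t ∈ X`, and the limit map is `K`-Lipschitz with values in the same ball
(diagonal extraction over a countable dense subset, then extension of the convergence to all
points by the uniform modulus `K`; the modulus passes to the limit). [folklore] -/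
theorem exists_strictMono_tendsto_of_lipschitzWith {X F : Type*} [PseudoMetricSpace X]
    [SeparableSpace X] [PseudoMetricSpace F] [ProperSpace F] {K : ℝ≥0} (x : ℕ → X → F)
    (hlip : ∀ n, LipschitzWith K (x n)) {c : F} {R : ℝ} (hb : ∀ n t, x n t ∈ closedBall c R) :
    ∃ (φ : ℕ → ℕ) (l : X → F), StrictMono φ ∧ LipschitzWith K l ∧ (∀ t, l t ∈ closedBall c R) ∧
      ∀ t, Tendsto (fun n => x (φ n) t) atTop (𝓝 (l t)) := by
  obtain ⟨D, hDc, hDd⟩ := TopologicalSpace.exists_countable_dense X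
  haveI : Countable D := hDc.to_subtype
  -- diagonal extraction over the countable dense set
  obtain ⟨φ, hφ, hconvD⟩ := FunctionSpaces.exists_strictMono_forall_tendsto
    (fun n (d : D) => x n (d : X)) fun d => ⟨c, R, fun n => hb n d⟩
  -- extension to every point by the uniform Lipschitz modulus
  have hconv : ∀ d ∈ D, ∃ l, Tendsto (fun n => x (φ n) d) atTop (𝓝 l) := fun d hd =>
    hconvD ⟨d, hd⟩
  have heq : ∀ ε, 0 < ε → ∃ δ, 0 < δ ∧ ∀ n, ∀ t ∈ (univ : Set X), ∀ d ∈ D,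
      dist t d < δ → dist (x (φ n) t) (x (φ n) d) < ε := by
    intro ε hε
    refine ⟨ε / (K + 1), by positivity, fun n t _ d _ htd => ?_⟩
    calc dist (x (φ n) t) (x (φ n) d) ≤ K * dist t d := (hlip (φ n)).dist_le_mul t d
      _ ≤ (K + 1) * dist t d := by gcongr; linarith
      _ < (K + 1) * (ε / (K + 1)) := by gcongr
      _ = ε := by field_simp
  have hall := FunctionSpaces.forall_exists_tendsto_of_subset_closure (S := univ)
    (by rw [hDd.closure_eq]) hconv heq
  choose l hl using fun t => hall t (mem_univ t)
  refine ⟨φ, l, hφ, ?_, fun t => ?_, hl⟩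
  · refine LipschitzWith.of_dist_le_mul fun t s => ?_
    exact FunctionSpaces.dist_lim_le_of_dist_le (hl t) (hl s)
      fun n => (hlip (φ n)).dist_le_mul t s
  · exact isClosed_closedBall.mem_of_tendsto (hl t) (Eventually.of_forall fun n => hb (φ n) t)

end Extraction

/-! ### Limits of bounded weak solutions -/

section Limit

variable {E : Type*} [NormedAddCommGroup E] [InnerProductSpace ℝ E] [FiniteDimensional ℝ E]
  [MeasurableSpace E] [BorelSpace E]

omit [MeasurableSpace E] [BorelSpace E] [FiniteDimensional ℝ E] [InnerProductSpace ℝ E] in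
/-- A space–time test field on the slab `(−∞, 0) × E` whose slices vanish off `[a', b]` is a
space–time test field on the slab `(A, 0) × E` for every `A < a'`, `b < 0`. [folklore] -/
theorem IsSpaceTimeTestOn.of_time_support [NormedSpace ℝ E] {F : Type*} [NormedAddCommGroup F]
    [NormedSpace ℝ F] {ψ : ℝ → E → F} (hψ : IsSpaceTimeTestOn (slab E (Iio 0) isOpen_Iio) ψ)
    {a' b A : ℝ} (hsupp : ∀ t, t ∉ Icc a' b → ψ t = 0) (hA : A < a') (hb : b < 0) :
    IsSpaceTimeTestOn (slab E (Ioo A 0) isOpen_Ioo) ψ := by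
  refine ⟨hψ.contDiff, hψ.hasCompactSupport, ?_⟩
  have hsub : support (uncurry ψ) ⊆ Icc a' b ×ˢ univ := by
    rintro ⟨t, x⟩ hz
    refine ⟨?_, mem_univ _⟩
    by_contra ht
    exact hz (by simp [hsupp t ht])
  intro z hz
  have hz' : z ∈ Icc a' b ×ˢ (univ : Set E) :=
    closure_minimal hsub (isClosed_Icc.prod isClosed_univ) hz
  rw [SetLike.mem_coe, mem_slab]
  exact ⟨hA.trans_le hz'.1.1, hz'.1.2.trans_lt hb⟩

omit [MeasurableSpace E] [BorelSpace E] in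
/-- Off its time support, a space–time test field and its derived fields vanish, so the
Navier–Stokes weak integrand vanishes there whatever the velocity. [folklore] -/
theorem weakIntegrand_eq_zero_of_notMem {ψ : ℝ → E → E} {a' b : ℝ}
    (hsupp : ∀ t, t ∉ Icc a' b → ψ t = 0) {t : ℝ} (ht : t ∉ Icc a' b) (w : E → E) (ν : ℝ)
    (x : E) :
    ⟪w x, timeDeriv ψ t x⟫ + ⟪w x, convect w (ψ t) x⟫ + ν * ⟪w x, Δ (ψ t) x⟫ = 0 := by
  have hopen : IsOpen (Icc a' b)ᶜ := isClosed_Icc.isOpen_compl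
  have hnear : (fun s => ψ s x) =ᶠ[𝓝 t] fun _ => (0 : E) :=
    Filter.eventually_of_mem (hopen.mem_nhds ht) fun s hs => by simp [hsupp s hs]
  have h1 : timeDeriv ψ t x = 0 := by
    rw [timeDeriv_apply, hnear.deriv_eq, deriv_const]
  have h2 : fderiv ℝ (ψ t) x = 0 := by
    rw [hsupp t ht]
    exact fderiv_const_apply 0
  have hx : x ∉ tsupport (ψ t) := by
    rw [hsupp t ht, tsupport_eq_empty_iff.2 rfl]; exact notMem_empty x
  have h3 : Δ (ψ t) x = 0 := laplacian_eq_zero_of_notMem_tsupport hx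
  rw [h1, convect_apply, h2, h3]
  simp

/-- **Limits of bounded weak solutions are bounded weak solutions** (the property of the limit
used in the proof of KNSS 2009, Thm. 6.1, p. 12, through Lemma 6.1 / Lemma 4.1). Let `V k` be
bounded weak solutions of Navier–Stokes (viscosity `ν`) on `ℝⁿ × (A_k, 0)` in the sense of KNSS
§4 (ii), each continuous on its open slab, with the uniform bound `‖V k (t, x)‖ ≤ M` and
`A_k → −∞`; suppose `V k (t, x) → v (t, x)` for every `t < 0` and every `x`, with `v` continuous
on `ℝ × ℝⁿ`. Then `v` is a bounded weak solution on `ℝⁿ × (−∞, 0)`: the bound and (a.e.) weak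
divergence-freeness pass to pointwise limits, and for a test field `ψ` supported in
`[a', b] × ℝⁿ`, `b < 0`, the weak identities of the `V k` on `(A_k, 0) ⊇ [a', b]` (large `k`)
converge to that of `v` by dominated convergence on `(a' − 1, b] × ℝⁿ` (integrand dominated by
`M‖∂ₜψ‖ + M²‖∇ψ‖ + |ν|M‖Δψ‖`). [cite: KochNadirashviliSereginSverak2009, Lemma 6.1 (p. 11) with Lemma 4.1 (p. 8) and proof of Thm 6.1 (p. 12), arXiv:0709.3599] -/
theorem isBoundedWeakNSSolutionOn_of_tendsto {ν M : ℝ} {A : ℕ → ℝ} {V : ℕ → ℝ → E → E}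
    {v : ℝ → E → E} (hA : Tendsto A atTop atBot)
    (hV : ∀ k, IsBoundedWeakNSSolutionOn (Ioo (A k) 0) isOpen_Ioo ν (V k))
    (hcont : ∀ k, ContinuousOn (uncurry (V k)) (Ioo (A k) 0 ×ˢ univ))
    (hbd : ∀ k, ∀ t ∈ Ioo (A k) 0, ∀ x, ‖V k t x‖ ≤ M) (hv : Continuous (uncurry v))
    (hlim : ∀ t < 0, ∀ x, Tendsto (fun k => V k t x) atTop (𝓝 (v t x))) :
    IsBoundedWeakNSSolutionOn (Iio 0) isOpen_Iio ν v := by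
  have hev : ∀ a : ℝ, ∀ᶠ k in atTop, A k < a := fun a => hA.eventually (eventually_lt_atBot a)
  refine ⟨hv.aestronglyMeasurable, ?_, ?_, ?_⟩
  · -- the bound passes to the limit
    refine ⟨M, fun t ht x => ?_⟩
    refine le_of_tendsto (hlim t ht x).norm ((hev t).mono fun k hk => hbd k t ⟨hk, ht⟩ x)
  · -- weak divergence-freeness of a.e. slice passes to the limit
    have hdivk : ∀ k, ∀ᵐ t ∂(volume.restrict (Iio (0 : ℝ))),
        t ∈ Ioo (A k) 0 → IsWeaklyDivFree (V k t) := by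
      intro k
      have h1 := (ae_restrict_iff' (measurableSet_Ioo (a := A k) (b := 0))).1
        (hV k).ae_isWeaklyDivFree
      exact ae_restrict_of_ae h1
    have hall := ae_all_iff.2 hdivk
    filter_upwards [hall, ae_restrict_mem measurableSet_Iio] with t ht ht0
    intro θ hθ
    have hθ1 : ContDiff ℝ 1 θ := contDiff_infty.1 hθ.contDiff 1
    have hgc : HasCompactSupport (gradient θ) := by
      have : gradient θ = (fun L => (InnerProductSpace.toDual ℝ E).symm L) ∘ fderiv ℝ θ := rfl
      rw [this]
      exact (hθ.hasCompactSupport.fderiv (𝕜 := ℝ)).comp_left (by simp)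
    have hθi : Integrable (fun x => M * ‖gradient θ x‖) volume :=
      (((continuous_gradient_of_contDiff hθ1).integrable_of_hasCompactSupport hgc).norm).const_mul M
    have hlimθ : Tendsto (fun k => ∫ x, ⟪V k t x, gradient θ x⟫) atTop
        (𝓝 (∫ x, ⟪v t x, gradient θ x⟫)) := by
      refine tendsto_integral_filter_of_dominated_convergence (fun x => M * ‖gradient θ x‖)
        ?_ ?_ hθi (Eventually.of_forall fun x => (hlim t ht0 x).inner tendsto_const_nhds)
      · filter_upwards [hev t] with k hk
        have hsl : Continuous (V k t) :=
          ((hcont k).comp_continuous (Continuous.prodMk_right t)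
            fun x => ⟨⟨hk, ht0⟩, mem_univ x⟩)
        exact (hsl.inner (continuous_gradient_of_contDiff hθ1)).aestronglyMeasurable
      · filter_upwards [hev t] with k hk
        exact Eventually.of_forall fun x => (norm_inner_le_norm _ _).trans
          (mul_le_mul_of_nonneg_right (hbd k t ⟨hk, ht0⟩ x) (norm_nonneg _))
    have hzero : ∀ᶠ k in atTop, ∫ x, ⟪V k t x, gradient θ x⟫ = 0 := by
      filter_upwards [hev t] with k hk
      exact ht k ⟨hk, ht0⟩ θ hθ
    exact tendsto_nhds_unique hlimθ (tendsto_const_nhds.congr' (hzero.mono fun k hk => hk.symm))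
  · -- the weak identity
    intro ψ hψ hdiv
    obtain ⟨a', b, ha'b, hb0, hsupp⟩ := hψ.exists_time_support_lt
    have hψ' : IsSpaceTimeTestOn (⊤ : Opens (ℝ × E)) ψ := hψ.mono le_top
    set a₀ : ℝ := a' - 1 with ha₀
    have ha₀a' : a₀ < a' := by rw [ha₀]; linarith
    -- the space–time integrand, for a velocity field `w`
    set G : (ℝ → E → E) → ℝ × E → ℝ := fun w z => ⟪w z.1 z.2, timeDeriv ψ z.1 z.2⟫ +
      ⟪w z.1 z.2, convect (w z.1) (ψ z.1) z.2⟫ + ν * ⟪w z.1 z.2, Δ (ψ z.1) z.2⟫ with hG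
    have hGzero : ∀ w : ℝ → E → E, ∀ t, t ∉ Icc a' b → ∀ x, G w (t, x) = 0 := fun w t ht x =>
      weakIntegrand_eq_zero_of_notMem hsupp ht (w t) ν x
    -- reduction of the time integrals to `(a₀, b]`
    have hIoc_sub : Ioc a₀ b ⊆ Iio (0 : ℝ) := fun t ht => ht.2.trans_lt hb0
    have hred : ∀ (w : ℝ → E → E) (I : Set ℝ), MeasurableSet I → Ioc a₀ b ⊆ I →
        ∫ t in I, ∫ x, G w (t, x) = ∫ t in Ioc a₀ b, ∫ x, G w (t, x) := by
      intro w I hI hsub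
      refine setIntegral_eq_of_subset_of_forall_sdiff_eq_zero hI hsub fun t ht => ?_
      have ht' : t ∉ Icc a' b := fun h' => ht.2 ⟨ha₀a'.trans_le h'.1, h'.2⟩
      simp only [hGzero w t ht', integral_zero]
    -- the identities of the `V k`, for `k` large, on `(a₀, b]`
    have hzero : ∀ᶠ k in atTop, ∫ t in Ioc a₀ b, ∫ x, G (V k) (t, x) = 0 := by
      filter_upwards [hev a₀] with k hk
      have hψk : IsSpaceTimeTestOn (slab E (Ioo (A k) 0) isOpen_Ioo) ψ :=
        hψ.of_time_support hsupp (hk.trans ha₀a') hb0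
      have key := (hV k).integral_eq_zero hψk hdiv
      rw [hred (V k) (Ioo (A k) 0) measurableSet_Ioo
        (fun t ht => ⟨hk.trans ht.1, ht.2.trans_lt hb0⟩)] at key
      exact key
    -- dominated convergence on the product `(a₀, b] × E`
    set π : Measure (ℝ × E) := ((volume : Measure ℝ).restrict (Ioc a₀ b)).prod volume with hπ
    have hπ' : π = (volume : Measure (ℝ × E)).restrict (Ioc a₀ b ×ˢ univ) := by
      rw [hπ, Measure.restrict_prod_eq_prod_univ, ← Measure.volume_eq_prod]
    have hπmem : ∀ᵐ z ∂π, z ∈ Ioc a₀ b ×ˢ (univ : Set E) := by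
      rw [hπ']; exact ae_restrict_mem (measurableSet_Ioc.prod MeasurableSet.univ)
    have hM0 : 0 ≤ M := by
      obtain ⟨k, hk⟩ := (hev a₀).exists
      exact (norm_nonneg _).trans (hbd k b ⟨hk.trans (ha₀a'.trans_le ha'b), hb0⟩ 0)
    -- continuity of the derived test fields
    have hc1 : Continuous (uncurry (timeDeriv ψ)) := hψ'.timeDeriv_top.continuous_uncurry
    have hc2 : Continuous (uncurry fun t x => fderiv ℝ (ψ t) x) := hψ'.fderiv_top.continuous_uncurry
    have hc3 : Continuous (uncurry fun t => Δ (ψ t)) := hψ'.laplacian_top.continuous_uncurry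
    -- the dominating function
    set bound : ℝ × E → ℝ := fun z => M * ‖timeDeriv ψ z.1 z.2‖ +
      M * M * ‖fderiv ℝ (ψ z.1) z.2‖ + |ν| * M * ‖Δ (ψ z.1) z.2‖ with hbound
    have hbound_int : Integrable bound π := by
      rw [hπ']
      refine Integrable.restrict ?_
      refine ((Integrable.const_mul ?_ M).add (Integrable.const_mul ?_ (M * M))).add
        (Integrable.const_mul ?_ (|ν| * M))
      · exact hc1.norm.integrable_of_hasCompactSupport hψ'.timeDeriv_top.hasCompactSupport.norm
      · exact hc2.norm.integrable_of_hasCompactSupport hψ'.fderiv_top.hasCompactSupport.norm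
      · exact hc3.norm.integrable_of_hasCompactSupport hψ'.laplacian_top.hasCompactSupport.norm
    -- measurability and domination of the integrands `G (V k)`, `k` large
    have hmeasG : ∀ w : ℝ → E → E, AEStronglyMeasurable (uncurry w) π →
        AEStronglyMeasurable (G w) π := by
      intro w hw
      have happ := (isBoundedBilinearMap_apply (𝕜 := ℝ) (E := E) (F := E)).continuous
      have h2 : AEStronglyMeasurable (fun z : ℝ × E => fderiv ℝ (ψ z.1) z.2 (w z.1 z.2)) π :=
        happ.comp_aestronglyMeasurable (hc2.aestronglyMeasurable.prodMk hw)
      exact ((hw.inner hc1.aestronglyMeasurable).add (hw.inner h2)).add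
        ((hw.inner hc3.aestronglyMeasurable).const_mul ν)
    have hnormG : ∀ (w : E → E) (t : ℝ) (x : E), ‖w x‖ ≤ M →
        ‖G (fun _ => w) (t, x)‖ ≤ bound (t, x) := by
      intro w t x hw
      simp only [hG, hbound, Real.norm_eq_abs]
      have e1 : |⟪w x, timeDeriv ψ t x⟫| ≤ M * ‖timeDeriv ψ t x‖ :=
        (abs_real_inner_le_norm _ _).trans (mul_le_mul_of_nonneg_right hw (norm_nonneg _))
      have e2 : |⟪w x, convect w (ψ t) x⟫| ≤ M * M * ‖fderiv ℝ (ψ t) x‖ := by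
        rw [convect_apply]
        calc |⟪w x, fderiv ℝ (ψ t) x (w x)⟫| ≤ ‖w x‖ * ‖fderiv ℝ (ψ t) x (w x)‖ :=
              abs_real_inner_le_norm _ _
          _ ≤ ‖w x‖ * (‖fderiv ℝ (ψ t) x‖ * ‖w x‖) := by
              gcongr; exact ContinuousLinearMap.le_opNorm _ _
          _ ≤ M * (‖fderiv ℝ (ψ t) x‖ * M) := by gcongr
          _ = M * M * ‖fderiv ℝ (ψ t) x‖ := by ring
      have e3 : |ν * ⟪w x, Δ (ψ t) x⟫| ≤ |ν| * M * ‖Δ (ψ t) x‖ := by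
        rw [abs_mul, mul_assoc]
        exact mul_le_mul_of_nonneg_left ((abs_real_inner_le_norm _ _).trans
          (mul_le_mul_of_nonneg_right hw (norm_nonneg _))) (abs_nonneg ν)
      calc |⟪w x, timeDeriv ψ t x⟫ + ⟪w x, convect w (ψ t) x⟫ + ν * ⟪w x, Δ (ψ t) x⟫|
          ≤ |⟪w x, timeDeriv ψ t x⟫| + |⟪w x, convect w (ψ t) x⟫| + |ν * ⟪w x, Δ (ψ t) x⟫| :=
            (abs_add_le _ _).trans (add_le_add (abs_add_le _ _) le_rfl)
        _ ≤ _ := add_le_add (add_le_add e1 e2) e3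
    have hVmeas : ∀ᶠ k in atTop, AEStronglyMeasurable (G (V k)) π := by
      filter_upwards [hev a₀] with k hk
      refine hmeasG (V k) ?_
      rw [hπ']
      exact ((hcont k).mono (prod_mono (fun t ht => ⟨hk.trans ht.1, ht.2.trans_lt hb0⟩)
        Subset.rfl)).aestronglyMeasurable (measurableSet_Ioc.prod MeasurableSet.univ)
    have hVbound : ∀ᶠ k in atTop, ∀ᵐ z ∂π, ‖G (V k) z‖ ≤ bound z := by
      filter_upwards [hev a₀] with k hk
      filter_upwards [hπmem] with z hz
      exact hnormG (V k z.1) z.1 z.2 (hbd k z.1 ⟨hk.trans hz.1.1, hz.1.2.trans_lt hb0⟩ z.2)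
    have hvmeas : AEStronglyMeasurable (G v) π := hmeasG v hv.aestronglyMeasurable
    have hvbound : ∀ᵐ z ∂π, ‖G v z‖ ≤ bound z := by
      filter_upwards [hπmem] with z hz
      refine hnormG (v z.1) z.1 z.2 ?_
      exact le_of_tendsto (hlim z.1 (hz.1.2.trans_lt hb0) z.2).norm
        ((hev z.1).mono fun k hk => hbd k z.1 ⟨hk, hz.1.2.trans_lt hb0⟩ z.2)
    have hGlim : ∀ᵐ z ∂π, Tendsto (fun k => G (V k) z) atTop (𝓝 (G v z)) := by
      filter_upwards [hπmem] with z hz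
      have hl := hlim z.1 (hz.1.2.trans_lt hb0) z.2
      simp only [hG, convect_apply]
      exact ((hl.inner tendsto_const_nhds).add
        (hl.inner (((fderiv ℝ (ψ z.1) z.2).continuous.tendsto _).comp hl))).add
        ((hl.inner tendsto_const_nhds).const_mul ν)
    have hDCT : Tendsto (fun k => ∫ z, G (V k) z ∂π) atTop (𝓝 (∫ z, G v z ∂π)) :=
      tendsto_integral_filter_of_dominated_convergence bound hVmeas hVbound hbound_int hGlim
    -- back to iterated integrals
    have hiter : ∀ w : ℝ → E → E, AEStronglyMeasurable (G w) π → (∀ᵐ z ∂π, ‖G w z‖ ≤ bound z) →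
        ∫ z, G w z ∂π = ∫ t in Ioc a₀ b, ∫ x, G w (t, x) := by
      intro w hw hwb
      have hint : Integrable (G w) π := hbound_int.mono' hw hwb
      rw [hπ] at hint
      rw [hπ, integral_prod _ hint]
    have hseq : ∀ᶠ k in atTop, ∫ z, G (V k) z ∂π = 0 := by
      filter_upwards [hVmeas, hVbound, hzero] with k h1 h2 h3
      rw [hiter (V k) h1 h2, h3]
    have hlim0 : ∫ z, G v z ∂π = 0 :=
      tendsto_nhds_unique hDCT (tendsto_const_nhds.congr' (hseq.mono fun k hk => hk.symm))
    -- conclusion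
    have hfin := hred v (Iio 0) measurableSet_Iio hIoc_sub
    simp only [hG] at hfin hiter hlim0 hvmeas hvbound
    rw [hfin, ← hiter v hvmeas hvbound, hlim0]

end Limit

/-! ### A continuous field with a.e. vanishing slices vanishes up to the final time -/

section Vanishing

/-- If `v : ℝ → ℝ³ → ℝ³` is jointly continuous and `v(t, ·) = 0` a.e. for a.e. `t < 0` (the
conclusion of KNSS 2009, Thm. 5.3, for the `L^∞` class), then `v = 0` on `(−∞, 0] × ℝ³`:
by `ae_eq_zero_slab_of_ae_slice` it vanishes a.e. on the open slab, hence everywhere there by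
continuity (`Measure.eqOn_open_of_ae_eq`), hence on its closure. [folklore] -/
theorem forall_eq_zero_of_ae_slice_eq_zero {v : ℝ → (EuclideanSpace ℝ (Fin 3)) → (EuclideanSpace ℝ (Fin 3))} (hv : Continuous (uncurry v))
    (h : ∀ᵐ t ∂(volume.restrict (Iio (0 : ℝ))), v t =ᵐ[volume] 0) :
    ∀ t ≤ 0, ∀ x, v t x = 0 := by
  have hslab := ae_eq_zero_slab_of_ae_slice (u := v)
    (hv.aestronglyMeasurable.mono_measure Measure.restrict_le_self) h
  have hopen : IsOpen (Iio (0 : ℝ) ×ˢ (univ : Set (EuclideanSpace ℝ (Fin 3)))) := isOpen_Iio.prod isOpen_univ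
  have heq : EqOn (uncurry v) 0 (Iio (0 : ℝ) ×ˢ (univ : Set (EuclideanSpace ℝ (Fin 3)))) :=
    Measure.eqOn_open_of_ae_eq hslab hopen hv.continuousOn continuousOn_const
  have hcl : EqOn (uncurry v) 0 (closure (Iio (0 : ℝ) ×ˢ (univ : Set (EuclideanSpace ℝ (Fin 3))))) :=
    heq.closure hv continuous_const
  intro t ht x
  have hmem : (t, x) ∈ closure (Iio (0 : ℝ) ×ˢ (univ : Set (EuclideanSpace ℝ (Fin 3)))) := by
    rw [closure_prod_eq, closure_Iio, closure_univ]
    exact ⟨ht, mem_univ x⟩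
  exact hcl hmem

end Vanishing

end Literature.Analysis.FluidPDE

end
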